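import Summits.ValiantsHypothesis.ValiantsHypothesis.Theorems.KPlusLogSqLawTropicalGradedWalkPotD

/-!
# Route «KPlusLogSqLaw» — GRW-lite (all-`m` `K = 4` family), part P-X: the row potentials of the EXCURSION states of the phases `w < m`

HONEST FRAMING.  Helper file of the chain `--supports` the crux `Summit.ValiantsHypothesis.ValiantsHypothesis.Theses.KPlusLogSqLaw.TropicalB`
(item `stmt-ValiantsHypothesis-19771`, route `KPlusLogSqLaw`; cell `pub-symmetroid`, seat val-sym-trop-p3 g14), on top of
`…TropicalGradedWalkDefs.lean` / `…PotD.lean`.  Census-side (lower bound) construction for `TropRootLawAt (n+1) 4`; nothing here bears on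
`TropicalB` in its window, `WeakLifting`, `MatrixDescartes` or `VP ≠ VNP`.

CONTENT.  The dual certificate for the dominance of the excursion state `(w, u, 1)` (`1 ≤ u ≤ w − 1`, `w < m`, slope
`θ = L·w + M·u + 4`, `thX`; Leibniz term: the diagonal term of `(w, u, 0)` with the rows of the columns `u − 1`, `u` exchanged —
column `u − 1` one level DOWN in class `3`, column `u` one level UP in class `1`): row potential `UX a = g·θ·a + muX (a − (m − w))`
with the bend `muX` = cumulative one-up steps `UB₂` (block pairs `j ≤ u − 2`), the two special steps at the exchanged rows `R₁`,
`R₂`, the one-up step of column `u + 1`, then one-down steps — in closed form (`SX2`, `SXR1`, `SXR2`, `SXP`, `SXL`).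
Slack lemmas: companion files `…GradedWalkDomX*.lean`; located basis: exact integer checks of the certificate for every `m ≤ 16`
(seat tools cert3.py).
-/

set_option linter.dupNamespace false
set_option autoImplicit false

namespace Summit.ValiantsHypothesis.ValiantsHypothesis.Theorems.LacunarySymmetroidMatrixDescartes.TropicalCensus

namespace GradedWalk

variable (n : ℕ)
/-! ### type-X potentials (excursion states `(w, u, 1)`, `1 ≤ u ≤ w − 1`, `w < m`) -/

/-- slope of the excursion state `(w, u, 1)` of a phase `w < m`: `L·w + M·u + 4`. -/
def thX (w u : ℕ) : ℤ := LL n * w + MM n * u + 4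
/-- bend over the block rows `1..jj`, `jj ≤ u − 2`: `Σ_{i ≤ jj} UB₂(i)` (at the slope `thX`). -/
def SX2 (w u jj : ℕ) : ℤ :=
  ((((-2 : ℤ) * T2 ((jj + 1)) * mZ n * (w : ℤ) + ((-10 : ℤ) * T2 ((jj + 1)) * mZ n ^ 2 + (-4 : ℤ) * (jj : ℤ) * mZ n * (u : ℤ))) + (((2 : ℤ) * (jj : ℤ) * mZ n * (w : ℤ) + (4 : ℤ) * (jj : ℤ) * mZ n ^ 2) + ((-32 : ℤ) * T2 ((jj + 1)) * mZ n + (-6 : ℤ) * T2 ((jj + 1)) * (w : ℤ)))) + (((2 : ℤ) * T6 ((jj + 1)) * mZ n + ((12 : ℤ) * (jj : ℤ) * mZ n + (-12 : ℤ) * (jj : ℤ) * (u : ℤ))) + (((6 : ℤ) * (jj : ℤ) * (w : ℤ) + (-4 : ℤ) * T2 ((jj + 1))) + ((5 : ℤ) * T6 ((jj + 1)) + (-8 : ℤ) * (jj : ℤ)))))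
/-- bend at the block row `u − 1` (the row `R₁` of the lifted class-`1` cell of column `u`). -/
def SXR1 (w u : ℕ) : ℤ :=
  ((((-2 : ℤ) * T2 ((u) - (1)) * mZ n * (w : ℤ) + ((-10 : ℤ) * T2 ((u) - (1)) * mZ n ^ 2 + (-2 : ℤ) * mZ n * (u : ℤ) ^ 2)) + (((-6 : ℤ) * mZ n ^ 2 * (u : ℤ) + (-32 : ℤ) * T2 ((u) - (1)) * mZ n) + ((-6 : ℤ) * T2 ((u) - (1)) * (w : ℤ) + (2 : ℤ) * T6 ((u) - (1)) * mZ n))) + ((((-20 : ℤ) * mZ n * (u : ℤ) + (6 : ℤ) * mZ n ^ 2) + ((-7 : ℤ) * (u : ℤ) ^ 2 + (-4 : ℤ) * T2 ((u) - (1)))) + (((5 : ℤ) * T6 ((u) - (1)) + (22 : ℤ) * mZ n) + ((-10 : ℤ) * (u : ℤ) + (18 : ℤ)))))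
/-- bend at the block row `u` (the row `R₂` of the lowered class-`3` cell of column `u − 1`). -/
def SXR2 (w u : ℕ) : ℤ :=
  (((((-2 : ℤ) * T2 ((u) - (1)) * mZ n * (w : ℤ) + (-10 : ℤ) * T2 ((u) - (1)) * mZ n ^ 2) + ((-2 : ℤ) * mZ n * (u : ℤ) * (w : ℤ) + (-16 : ℤ) * mZ n ^ 2 * (u : ℤ))) + (((-32 : ℤ) * T2 ((u) - (1)) * mZ n + (-6 : ℤ) * T2 ((u) - (1)) * (w : ℤ)) + ((2 : ℤ) * T6 ((u) - (1)) * mZ n + ((-56 : ℤ) * mZ n * (u : ℤ) + (2 : ℤ) * mZ n * (w : ℤ))))) + ((((10 : ℤ) * mZ n ^ 2 + (-6 : ℤ) * (u : ℤ) * (w : ℤ)) + ((-2 : ℤ) * (u : ℤ) ^ 2 + (-4 : ℤ) * T2 ((u) - (1)))) + (((5 : ℤ) * T6 ((u) - (1)) + (35 : ℤ) * mZ n) + ((-26 : ℤ) * (u : ℤ) + ((6 : ℤ) * (w : ℤ) + (13 : ℤ))))))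
/-- bend at the block row `u + 1`. -/
def SXP (w u : ℕ) : ℤ :=
  (((((-2 : ℤ) * T2 ((u) - (1)) * mZ n * (w : ℤ) + (-10 : ℤ) * T2 ((u) - (1)) * mZ n ^ 2) + ((-4 : ℤ) * mZ n * (u : ℤ) * (w : ℤ) + (2 : ℤ) * mZ n * (u : ℤ) ^ 2)) + (((-26 : ℤ) * mZ n ^ 2 * (u : ℤ) + (-32 : ℤ) * T2 ((u) - (1)) * mZ n) + ((-6 : ℤ) * T2 ((u) - (1)) * (w : ℤ) + ((2 : ℤ) * T6 ((u) - (1)) * mZ n + (-88 : ℤ) * mZ n * (u : ℤ))))) + ((((2 : ℤ) * mZ n * (w : ℤ) + (6 : ℤ) * mZ n ^ 2) + ((-12 : ℤ) * (u : ℤ) * (w : ℤ) + ((3 : ℤ) * (u : ℤ) ^ 2 + (-4 : ℤ) * T2 ((u) - (1))))) + (((5 : ℤ) * T6 ((u) - (1)) + (26 : ℤ) * mZ n) + ((-32 : ℤ) * (u : ℤ) + ((6 : ℤ) * (w : ℤ) + (13 : ℤ))))))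
/-- bend at the block rows `jj ≥ u + 2`: `SXP + Σ_{u+2 ≤ i ≤ jj} LB₁(i)`. -/
def SXL (w u jj : ℕ) : ℤ :=
  ((((((-2 : ℤ) * T2 ((jj + 1)) * mZ n * (w : ℤ) + (-10 : ℤ) * T2 ((jj + 1)) * mZ n ^ 2) + ((2 : ℤ) * T2 ((u + 2)) * mZ n * (w : ℤ) + (10 : ℤ) * T2 ((u + 2)) * mZ n ^ 2)) + (((-2 : ℤ) * T2 ((u) - (1)) * mZ n * (w : ℤ) + (-10 : ℤ) * T2 ((u) - (1)) * mZ n ^ 2) + ((-2 : ℤ) * (jj : ℤ) * mZ n * (u : ℤ) + ((2 : ℤ) * (jj : ℤ) * mZ n * (w : ℤ) + (6 : ℤ) * (jj : ℤ) * mZ n ^ 2)))) + ((((-6 : ℤ) * mZ n * (u : ℤ) * (w : ℤ) + (4 : ℤ) * mZ n * (u : ℤ) ^ 2) + ((-32 : ℤ) * mZ n ^ 2 * (u : ℤ) + (-34 : ℤ) * T2 ((jj + 1)) * mZ n)) + (((-6 : ℤ) * T2 ((jj + 1)) * (w : ℤ) + (34 : ℤ) * T2 ((u + 2)) * mZ n)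 + ((6 : ℤ) * T2 ((u + 2)) * (w : ℤ) + ((-32 : ℤ) * T2 ((u) - (1)) * mZ n + (-6 : ℤ) * T2 ((u) - (1)) * (w : ℤ)))))) + (((((2 : ℤ) * T6 ((jj + 1)) * mZ n + (-2 : ℤ) * T6 ((u + 2)) * mZ n) + ((2 : ℤ) * T6 ((u) - (1)) * mZ n + (20 : ℤ) * (jj : ℤ) * mZ n)) + (((-6 : ℤ) * (jj : ℤ) * (u : ℤ) + (6 : ℤ) * (jj : ℤ) * (w : ℤ)) + ((-106 : ℤ) * mZ n * (u : ℤ) + ((-18 : ℤ) * (u : ℤ) * (w : ℤ) + (9 : ℤ) * (u : ℤ) ^ 2)))) + ((((-10 : ℤ) * T2 ((jj + 1)) + (10 : ℤ) * T2 ((u + 2))) + ((-4 : ℤ) * T2 ((u) - (1)) + ((5 : ℤ) * T6 ((jj + 1)) + (-5 : ℤ) * T6 ((u + 2))))) + (((5 : ℤ) * T6 ((u) - (1)) + (2 : ℤ) * (jj : ℤ)) + ((6 : ℤ) * mZ n + ((-28 : ℤ) * (u : ℤ) + (11 : ℤ)))))))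

/-- `u = 1`: bend at the junction row (the lifted row `R₁`). -/
def SX1R1 (w : ℕ) : ℤ :=
  (((2 : ℤ) * mZ n * (w : ℤ) + (4 : ℤ) * mZ n ^ 2) + ((8 : ℤ) * mZ n + ((6 : ℤ) * (w : ℤ) + (-19 : ℤ))))
/-- `u = 1`: bend at the row `R₂ = m − w + 1`. -/
def SX1R2 (w : ℕ) : ℤ :=
  (((2 : ℤ) * mZ n * (w : ℤ) + (-2 : ℤ) * mZ n ^ 2) + ((-13 : ℤ) * mZ n + ((6 : ℤ) * (w : ℤ) + (-35 : ℤ))))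
/-- `u = 1`: bend at the row `m − w + 2`. -/
def SX1P : ℤ :=
  ((-16 : ℤ) * mZ n ^ 2 + ((-52 : ℤ) * mZ n + (-36 : ℤ)))
/-- `u = 1`: bend at the block rows `jj ≥ 3`. -/
def SX1L (w jj : ℕ) : ℤ :=
  (((((2 : ℤ) * T2 (3) * mZ n * (w : ℤ) + ((10 : ℤ) * T2 (3) * mZ n ^ 2 + (-2 : ℤ) * T2 ((jj + 1)) * mZ n * (w : ℤ))) + ((-10 : ℤ) * T2 ((jj + 1)) * mZ n ^ 2 + ((2 : ℤ) * (jj : ℤ) * mZ n * (w : ℤ) + (6 : ℤ) * (jj : ℤ) * mZ n ^ 2))) + (((34 : ℤ) * T2 (3) * mZ n + ((6 : ℤ) * T2 (3) * (w : ℤ) + (-34 : ℤ) * T2 ((jj + 1)) * mZ n)) + ((-6 : ℤ) * T2 ((jj + 1)) * (w : ℤ) + ((-2 : ℤ) * T6 (3) * mZ n + (2 : ℤ) * T6 ((jj + 1)) * mZ n)))) + ((((18 : ℤ) * (jj : ℤ) * mZ n + ((6 : ℤ) * (jj : ℤ) * (w : ℤ) + (-4 : ℤ) * mZ n * (w : ℤ)))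 + ((-28 : ℤ) * mZ n ^ 2 + ((10 : ℤ) * T2 (3) + (-10 : ℤ) * T2 ((jj + 1))))) + (((-5 : ℤ) * T6 (3) + ((5 : ℤ) * T6 ((jj + 1)) + (-4 : ℤ) * (jj : ℤ))) + ((-88 : ℤ) * mZ n + ((-12 : ℤ) * (w : ℤ) + (-28 : ℤ))))))

/-- `u = 1`: the bend as a function of the shifted index `j' = a − (n − w)` (`j' = 1` is the junction row). -/
def muX1 (w j' : ℕ) : ℤ :=
  if j' = 0 then 0 else if j' = 1 then SX1R1 n w else if j' = 2 then SX1R2 n w else if j' = 3 then SX1P n else SX1L n w (j' - 1)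

/-- the row potential of the excursion state `(w, 1, 1)`. -/
def UX1 (w a : ℕ) : ℤ := gG n * thX n w 1 * a + muX1 n w (a - (n - w))

/-- the bend of the row potential of the excursion state `(w, u, 1)` at block row `j`. -/
def muX (w u j : ℕ) : ℤ :=
  if j + 2 ≤ u then SX2 n w u j else if j + 1 = u then SXR1 n w u else if j = u then SXR2 n w u
  else if j = u + 1 then SXP n w u else SXL n w u j

/-- the row potential of the excursion state `(w, u, 1)`. -/
def UX (w u a : ℕ) : ℤ := gG n * thX n w u * a + muX n w u (a - (n + 1 - w))

/-! ### small interface lemmas -/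

/-- the slope of the excursion state `(w, u, 1)`, `u < w < m`, is `thX`. -/
theorem theta_X {w u : ℕ} (huw : u < w) (hw : w < n + 1) : theta n w u 1 = thX n w u := by
  unfold theta thX Mw
  rw [if_neg (by omega), if_pos huw]
  push_cast; ring

/-- bend regime `j ≤ u − 2`. -/
theorem muX_lt {w u j : ℕ} (h : j + 2 ≤ u) : muX n w u j = SX2 n w u j := by
  unfold muX; rw [if_pos h]
/-- bend at `R₁`. -/
theorem muX_R1 {w u j : ℕ} (h : j + 1 = u) : muX n w u j = SXR1 n w u := by
  unfold muX; rw [if_neg (by omega), if_pos h]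
/-- bend at `R₂`. -/
theorem muX_R2 (w u : ℕ) : muX n w u u = SXR2 n w u := by
  unfold muX; rw [if_neg (by omega), if_neg (by omega), if_pos rfl]
/-- bend at `u + 1`. -/
theorem muX_P (w u : ℕ) : muX n w u (u + 1) = SXP n w u := by
  unfold muX; rw [if_neg (by omega), if_neg (by omega), if_neg (by omega), if_pos rfl]
/-- bend regime `j ≥ u + 2`. -/
theorem muX_ge {w u j : ℕ} (h : u + 2 ≤ j) : muX n w u j = SXL n w u j := by
  unfold muX; rw [if_neg (by omega), if_neg (by omega), if_neg (by omega), if_neg (by omega)]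
/-- `u = 1` bend values. -/
theorem muX1_zero (w : ℕ) : muX1 n w 0 = 0 := by unfold muX1; rw [if_pos rfl]
/-- `u = 1` bend values. -/
theorem muX1_one (w : ℕ) : muX1 n w 1 = SX1R1 n w := by unfold muX1; rw [if_neg (by omega), if_pos rfl]
/-- `u = 1` bend values. -/
theorem muX1_two (w : ℕ) : muX1 n w 2 = SX1R2 n w := by unfold muX1; rw [if_neg (by omega), if_neg (by omega), if_pos rfl]
/-- `u = 1` bend values. -/
theorem muX1_three (w : ℕ) : muX1 n w 3 = SX1P n := by
  unfold muX1; rw [if_neg (by omega), if_neg (by omega), if_neg (by omega), if_pos rfl]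
/-- `u = 1` bend values. -/
theorem muX1_ge {w j : ℕ} (h : 4 ≤ j) : muX1 n w j = SX1L n w (j - 1) := by
  unfold muX1; rw [if_neg (by omega), if_neg (by omega), if_neg (by omega), if_neg (by omega)]

/-- no bend at the junction row (`u ≥ 2`). -/
theorem muX_zero {w u : ℕ} (hu : 2 ≤ u) : muX n w u 0 = 0 := by
  rw [muX_lt n (by omega)]; simp [SX2, T2, T6]

end GradedWalk

end Summit.ValiantsHypothesis.ValiantsHypothesis.Theorems.LacunarySymmetroidMatrixDescartes.TropicalCensus
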